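/-
Copyright: cell `pub-balaban-gaps` (G2), seat ne6 (row NE7b), `prover-pub-balaban-gaps-ne6-g15-0`, on leaf-01 g80's `CompactFibreRelative` (OWNER lineage `t4-ne7b-p1` g106's
`CompactFibreCarrier`). Project licence.
-/
import Summits.QuantumFields.BalabanUV.T4Continuum.Spine.NE7b.CompactFibreWindowSUN
import Summits.QuantumFields.BalabanUV.T4Continuum.Spine.NE7b.CompactFibreRelative
import Mathlib.MeasureTheory.Integral.Pi

/-!
# THE PROFILE (INTEGRATED-DENOMINATOR) LETTER ON THE `SU(N)` PRODUCT FIBRE, ALL `N`: `−log ∫_{Π_b SB_η} e^{−q} dκ ≤ q₀ + b` for ANY inner-window letter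
# `b ≥ −log κ(Π_b SB_ρ)` (`CompactFibreWindowSUN`: `N²·log(2∕ρ) − log C` per bond; `…SUNRate`: `(N² − 1)·log ρ⁻¹ + c`; `…SUNExplicit`: explicit), the quadratic trace profile
# `(2σ)⁻¹Σ_b Re tr(1 − v_b)` (`≤ #bonds·ρ²∕(4σ)` on the inner window), its EXACT factorisation over the bonds, and the creation-step price in print's (1.2) shape with
# the letter folded — the all-`N` form of `CompactFibreProfileVolumeSU2` (row NE7b, node U5c; MODEL, [folklore])

Cell `pub-balaban-gaps` (G2 spine census, V35) for the `pub-balaban` T⁴ crux NE7b (`T4WeightBudget.RelWeightBound`; the cell's OWN estimate — NOT PRINTED in [Bałaban 1983–89], NOT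
PROVED).  Crux-route MODEL work under `Spine/NE7b/`; NOTHING of Bałaban's is named or asserted; no `def`; zero `sorry`.  Imports (oleans present): this seat's `CompactFibreWindowSUN` (V20:
the Hilbert–Schmidt window `SB ρ = {V : SU(N) | ‖V − 1‖_HS ≤ ρ}`, `measurableSet_sball`, `exists_neg_log_pi_sball_le`), leaf-01's `CompactFibreRelative` (`relFibre_moment_le_of_centredProfile`)
and Mathlib's `MeasureTheory.Integral.Pi` (`integral_fintype_prod_eq_pow`).  `CompactFibreProfileVolumeSU2` (V27, the `SU(2)` trace-window model) is NOT imported (its farm olean is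
unbuilt at write time); its generic §1 is re-derived inline inside the proofs below, not restated.

WHY.  [Balaban1989LargeFieldII] p. 356 (1.2) ∕ (1.10) INTEGRATES the denominator's Gaussian over the window («`(−½d(𝔤)log g_k⁻² + log σ₀)|Λ^{(k)}∖G₀|`»).  V27 typed that shape in the
`SU(2)` model; V29–V33 (this gen) moved the window letter, the centred windows, the relative interaction letter and the creation price to the headline's `SU(N)`, every `N`.  THIS
FILE completes the set with the integrated shape for all `N`: the profile letter with the window letter ABSTRACT (so that V20 ∕ V29 ∕ V33 value it by one line each), the quadratic
trace profile (`Re tr(1 − v) = ½‖v − 1‖²_HS`, the tree's Lemma 7.2), its exact factorisation, and the junction with leaf-01's centred-profile sandwich.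

WHAT IS PROVED ([folklore]), `κ` = product Haar probability on `bonds → SU(N)`:
* §1 `pi_sball_mono`; **`neg_log_profileVolume_le`** (`0 < ρ ≤ η`, `q ≤ q₀` on `Π_b SB_ρ`, `e^{−q}` integrable on `Π_b SB_η`, `κ(Π_b SB_ρ) > 0`, `−log κ(Π_b SB_ρ) ≤ b` ⊢
  `−log ∫_{Π SB_η} e^{−q} dκ ≤ q₀ + b`); `profileVolume_pos`; BY VALUE today `exists_neg_log_profileVolume_le` (V20's letter: `q₀ + #bonds·(N²·log(2∕ρ) − log C)`, `0 < ρ ≤ 2`).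
* §2 the quadratic trace profile: `re_trace_one_sub_nonneg`, `measurable_traceDeficitSum`, `quadProfile_le_on_innerWindow` (`≤ #bonds·ρ²∕(4σ)` on `Π_b SB_ρ`), `integrable_exp_neg_quadProfile`,
  **`neg_log_quadProfileVolume_le`** (`≤ #bonds·ρ²∕(4σ) + b`; at `ρ² = 2σ`: `#bonds∕2 + b`, V27's shape).
* §3 **`profileVolume_eq_pow`** (EXACT factorisation on `SU(N)`: `∫_{Π_b s} exp(−c·Σ_b f(v_b)) d(⊗μ) = (∫_s exp(−c·f) dμ)^{#bonds}` — the letter is ADDITIVE over the bonds),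
  `quadProfileVolume_eq_pow`, **`le_neg_log_profileVolume`** (the other side from any LOWER window letter, `q ≥ 0`).
* §4 **`creationPrice_SUN_profile_valued`** — leaf-01's `relFibre_moment_le_of_centredProfile` on the `SU(N)` product fibre with the Hilbert–Schmidt deviation and the window-complement
  floor (as in V32), the denominator's letter folded: `∫ F·w·e^{−I} ≤ exp(−(λ∕2)δ′² + q₀ + b)·(∫F dκ)·∫ G·w·e^{−I}`.

HONEST REMARKS.  MODEL only; the letter `b` is whatever the window files supply (V20: exponent `N²`; V29: `N² − 1` soft; V33: explicit); which `σ = g_k²`, `ρ(g_k)`, `q₀` print's step carries,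
`λ` (print's `γ₀W⁻¹`), and that Bałaban's creation-level carrier IS this one are (A3) ∕ (A1c), NC-NE7b-α UNRULED.  BY-NAME EFFECT ON THE WALL: NONE.  NE7b NOT PRINTED ∕ NOT PROVED;
spine PROVED 0∕9; rung (B)+1 on ONE finite T⁴ — NOT infinite volume, NOT the mass gap, NOT Clay.
HONEST DEPENDENCY: continuum YM on T⁴ ⇐ BetaPertH ∧ nine spine estimates (0/9 proved); BetaPertH ⇐ (D1) ∧ (D4) ∧ CAP+tail;
G-an2-4 gates asym, D1 and NE2/3/4.  This file changes none of it.
-/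

set_option autoImplicit false

noncomputable section

open MeasureTheory Real Finset
open scoped Matrix.Norms.Frobenius
open Literature.MathematicalPhysics.QuantumFieldTheory (haarProbability)
open Literature.MathematicalPhysics.QuantumFieldTheory.UnitaryCayley (re_trace_one_sub)
open Summit.QuantumFields.BalabanUV.T4Continuum.NE7b.CompactFibreWindowSUN (measurableSet_sball exists_neg_log_pi_sball_le)
open Summit.QuantumFields.BalabanUV.T4Continuum.NE7b.CompactFibreRelative (relFibre_moment_le_of_centredProfile)

namespace Summit.QuantumFields.BalabanUV.T4Continuum.NE7b.CompactFibreProfileVolumeSUN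

variable {N : ℕ} {B : Type*} [Fintype B]

/-! ## §1 The profile letter from an inner window, letter abstract -/

omit [Fintype B] in
/-- Product Hilbert–Schmidt windows are monotone in the radius: `Π_b SB_ρ ⊆ Π_b SB_η` for `ρ ≤ η`. [folklore] -/
theorem pi_sball_mono {ρ η : ℝ} (h : ρ ≤ η) :
    (Set.univ.pi fun _ : B => {V : Matrix.specialUnitaryGroup (Fin N) ℂ | ‖(V : Matrix (Fin N) (Fin N) ℂ) - 1‖ ≤ ρ}) ⊆
      (Set.univ.pi fun _ : B => {V : Matrix.specialUnitaryGroup (Fin N) ℂ | ‖(V : Matrix (Fin N) (Fin N) ℂ) - 1‖ ≤ η}) :=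
  Set.pi_mono fun _ _ _ hU => le_trans hU h

/-- **THE PROFILE VOLUME LETTER, `SU(N)`, ALL `N`, WINDOW LETTER ABSTRACT**: for the product Haar probability `κ` on `bonds → SU(N)`, windows `Π_b SB_η ⊇ Π_b SB_ρ` (`ρ ≤ η`), a profile
`q ≤ q₀` on the inner window with `e^{−q}` integrable on the outer one, and an inner-window letter `κ(Π_b SB_ρ) > 0`, `−log κ(Π_b SB_ρ) ≤ b`: `−log ∫_{Π SB_η} e^{−q} dκ ≤ q₀ + b`
(`e^{−q₀}·κ(Π SB_ρ) ≤ ∫_{Π SB_ρ} e^{−q} ≤ ∫_{Π SB_η} e^{−q}`). [folklore] -/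
theorem neg_log_profileVolume_le {ρ η q₀ b : ℝ} (hρη : ρ ≤ η)
    (hpos : 0 < ((Measure.pi fun _ : B => haarProbability (Matrix.specialUnitaryGroup (Fin N) ℂ)) (Set.univ.pi fun _ : B => {V : Matrix.specialUnitaryGroup (Fin N) ℂ | ‖(V : Matrix (Fin N) (Fin N) ℂ) - 1‖ ≤ ρ})).toReal)
    (hvol : -Real.log ((Measure.pi fun _ : B => haarProbability (Matrix.specialUnitaryGroup (Fin N) ℂ)) (Set.univ.pi fun _ : B => {V : Matrix.specialUnitaryGroup (Fin N) ℂ | ‖(V : Matrix (Fin N) (Fin N) ℂ) - 1‖ ≤ ρ})).toReal ≤ b)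
    (q : (B → Matrix.specialUnitaryGroup (Fin N) ℂ) → ℝ)
    (hq : ∀ v ∈ (Set.univ.pi fun _ : B => {V : Matrix.specialUnitaryGroup (Fin N) ℂ | ‖(V : Matrix (Fin N) (Fin N) ℂ) - 1‖ ≤ ρ}), q v ≤ q₀)
    (hint : IntegrableOn (fun v => exp (-q v)) (Set.univ.pi fun _ : B => {V : Matrix.specialUnitaryGroup (Fin N) ℂ | ‖(V : Matrix (Fin N) (Fin N) ℂ) - 1‖ ≤ η})
      (Measure.pi fun _ : B => haarProbability (Matrix.specialUnitaryGroup (Fin N) ℂ))) :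
    -Real.log (∫ v in (Set.univ.pi fun _ : B => {V : Matrix.specialUnitaryGroup (Fin N) ℂ | ‖(V : Matrix (Fin N) (Fin N) ℂ) - 1‖ ≤ η}), exp (-q v) ∂(Measure.pi fun _ : B => haarProbability (Matrix.specialUnitaryGroup (Fin N) ℂ)))
      ≤ q₀ + b := by
  set κ : Measure (B → Matrix.specialUnitaryGroup (Fin N) ℂ) := Measure.pi fun _ : B => haarProbability (Matrix.specialUnitaryGroup (Fin N) ℂ) with hκ
  set W' : Set (B → Matrix.specialUnitaryGroup (Fin N) ℂ) := Set.univ.pi fun _ : B => {V : Matrix.specialUnitaryGroup (Fin N) ℂ | ‖(V : Matrix (Fin N) (Fin N) ℂ) - 1‖ ≤ ρ} with hW'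
  set W : Set (B → Matrix.specialUnitaryGroup (Fin N) ℂ) := Set.univ.pi fun _ : B => {V : Matrix.specialUnitaryGroup (Fin N) ℂ | ‖(V : Matrix (Fin N) (Fin N) ℂ) - 1‖ ≤ η} with hW
  have hW'm : MeasurableSet W' := MeasurableSet.univ_pi fun _ => measurableSet_sball ρ
  have hsub : W' ⊆ W := pi_sball_mono hρη
  -- `e^{−q₀}·κ(W′) ≤ ∫_{W′} e^{−q} ≤ ∫_W e^{−q}`
  have h1 : exp (-q₀) * (κ W').toReal ≤ ∫ v in W', exp (-q v) ∂κ := by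
    rw [← measureReal_def]
    exact setIntegral_ge_of_const_le_real hW'm (measure_ne_top _ _) (fun v hv => Real.exp_le_exp.2 (by linarith [hq v hv])) (hint.mono_set hsub)
  have h2 : ∫ v in W', exp (-q v) ∂κ ≤ ∫ v in W, exp (-q v) ∂κ :=
    setIntegral_mono_set hint (Filter.Eventually.of_forall fun v => (exp_pos _).le) hsub.eventuallyLE
  have hpos' : 0 < exp (-q₀) * (κ W').toReal := by positivity
  have hlog := Real.log_le_log hpos' (h1.trans h2)
  rw [Real.log_mul (exp_pos _).ne' hpos.ne', Real.log_exp] at hlog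
  linarith

/-- Positivity of the integrated profile under the same hypotheses (the `hqpos` input of leaf-01's `relFibre_moment_le_of_centredProfile`). [folklore] -/
theorem profileVolume_pos {ρ η q₀ : ℝ} (hρη : ρ ≤ η)
    (hpos : 0 < ((Measure.pi fun _ : B => haarProbability (Matrix.specialUnitaryGroup (Fin N) ℂ)) (Set.univ.pi fun _ : B => {V : Matrix.specialUnitaryGroup (Fin N) ℂ | ‖(V : Matrix (Fin N) (Fin N) ℂ) - 1‖ ≤ ρ})).toReal)
    (q : (B → Matrix.specialUnitaryGroup (Fin N) ℂ) → ℝ)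
    (hq : ∀ v ∈ (Set.univ.pi fun _ : B => {V : Matrix.specialUnitaryGroup (Fin N) ℂ | ‖(V : Matrix (Fin N) (Fin N) ℂ) - 1‖ ≤ ρ}), q v ≤ q₀)
    (hint : IntegrableOn (fun v => exp (-q v)) (Set.univ.pi fun _ : B => {V : Matrix.specialUnitaryGroup (Fin N) ℂ | ‖(V : Matrix (Fin N) (Fin N) ℂ) - 1‖ ≤ η})
      (Measure.pi fun _ : B => haarProbability (Matrix.specialUnitaryGroup (Fin N) ℂ))) :
    0 < ∫ v in (Set.univ.pi fun _ : B => {V : Matrix.specialUnitaryGroup (Fin N) ℂ | ‖(V : Matrix (Fin N) (Fin N) ℂ) - 1‖ ≤ η}), exp (-q v) ∂(Measure.pi fun _ : B => haarProbability (Matrix.specialUnitaryGroup (Fin N) ℂ)) := by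
  set κ : Measure (B → Matrix.specialUnitaryGroup (Fin N) ℂ) := Measure.pi fun _ : B => haarProbability (Matrix.specialUnitaryGroup (Fin N) ℂ) with hκ
  have hW'm : MeasurableSet (Set.univ.pi fun _ : B => {V : Matrix.specialUnitaryGroup (Fin N) ℂ | ‖(V : Matrix (Fin N) (Fin N) ℂ) - 1‖ ≤ ρ}) :=
    MeasurableSet.univ_pi fun _ => measurableSet_sball ρ
  have h1 : exp (-q₀) * (κ (Set.univ.pi fun _ : B => {V : Matrix.specialUnitaryGroup (Fin N) ℂ | ‖(V : Matrix (Fin N) (Fin N) ℂ) - 1‖ ≤ ρ})).toReal ≤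
      ∫ v in (Set.univ.pi fun _ : B => {V : Matrix.specialUnitaryGroup (Fin N) ℂ | ‖(V : Matrix (Fin N) (Fin N) ℂ) - 1‖ ≤ ρ}), exp (-q v) ∂κ := by
    rw [← measureReal_def]
    exact setIntegral_ge_of_const_le_real hW'm (measure_ne_top _ _) (fun v hv => Real.exp_le_exp.2 (by linarith [hq v hv])) (hint.mono_set (pi_sball_mono hρη))
  have h2 := setIntegral_mono_set hint (Filter.Eventually.of_forall fun v => (exp_pos _).le) (pi_sball_mono (N := N) (B := B) hρη).eventuallyLE
  exact lt_of_lt_of_le (by positivity) (h1.trans h2)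

/-- **BY VALUE TODAY** (V20's letter, exponent `N²`; V29 ∕ V33 lower it to `N² − 1` by the same line): there is `C > 0` such that for `0 < ρ ≤ 2`, `ρ ≤ η`, every profile `q ≤ q₀` on
`Π_b SB_ρ` with `e^{−q}` integrable on `Π_b SB_η` has `−log ∫_{Π SB_η} e^{−q} dκ ≤ q₀ + #bonds·(N²·log(2∕ρ) − log C)`. [folklore] -/
theorem exists_neg_log_profileVolume_le :
    ∃ C : ℝ, 0 < C ∧ ∀ ρ η q₀ : ℝ, 0 < ρ → ρ ≤ 2 → ρ ≤ η → ∀ q : (B → Matrix.specialUnitaryGroup (Fin N) ℂ) → ℝ,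
      (∀ v ∈ (Set.univ.pi fun _ : B => {V : Matrix.specialUnitaryGroup (Fin N) ℂ | ‖(V : Matrix (Fin N) (Fin N) ℂ) - 1‖ ≤ ρ}), q v ≤ q₀) →
      IntegrableOn (fun v => exp (-q v)) (Set.univ.pi fun _ : B => {V : Matrix.specialUnitaryGroup (Fin N) ℂ | ‖(V : Matrix (Fin N) (Fin N) ℂ) - 1‖ ≤ η})
        (Measure.pi fun _ : B => haarProbability (Matrix.specialUnitaryGroup (Fin N) ℂ)) →
      -Real.log (∫ v in (Set.univ.pi fun _ : B => {V : Matrix.specialUnitaryGroup (Fin N) ℂ | ‖(V : Matrix (Fin N) (Fin N) ℂ) - 1‖ ≤ η}), exp (-q v) ∂(Measure.pi fun _ : B => haarProbability (Matrix.specialUnitaryGroup (Fin N) ℂ)))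
        ≤ q₀ + (Fintype.card B : ℝ) * ((N * N : ℝ) * Real.log (2 / ρ) - Real.log C) := by
  obtain ⟨C, hC, h⟩ := exists_neg_log_pi_sball_le (N := N) (B := B)
  refine ⟨C, hC, fun ρ η q₀ hρ hρ2 hρη q hq hint => ?_⟩
  obtain ⟨hpos, hlog⟩ := h ρ hρ hρ2
  exact neg_log_profileVolume_le hρη hpos hlog q hq hint

/-! ## §2 The quadratic trace profile `(2σ)⁻¹·Σ_b Re tr(1 − v_b)` on `SU(N)` — the model of `½g_k⁻²|B′|²` at `σ = g_k²` -/

/-- `Re tr(1 − U) ≥ 0` on `SU(N)` (it is `½‖1 − U‖²_HS`, the tree's Lemma 7.2 `re_trace_one_sub`). [folklore] -/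
theorem re_trace_one_sub_nonneg (U : Matrix.specialUnitaryGroup (Fin N) ℂ) : 0 ≤ (Matrix.trace (1 - (U : Matrix (Fin N) (Fin N) ℂ))).re := by
  rw [re_trace_one_sub (Matrix.mem_specialUnitaryGroup_iff.1 U.2).1]; positivity

/-- On the window `SB_ρ`: `Re tr(1 − U) ≤ ρ²∕2`. [folklore] -/
theorem re_trace_one_sub_le_of_mem_sball {ρ : ℝ} {U : Matrix.specialUnitaryGroup (Fin N) ℂ} (hU : ‖(U : Matrix (Fin N) (Fin N) ℂ) - 1‖ ≤ ρ) :
    (Matrix.trace (1 - (U : Matrix (Fin N) (Fin N) ℂ))).re ≤ ρ ^ 2 / 2 := by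
  rw [re_trace_one_sub (Matrix.mem_specialUnitaryGroup_iff.1 U.2).1, norm_sub_rev]
  have h := pow_le_pow_left₀ (norm_nonneg _) hU 2
  linarith

/-- The summed trace deficit is measurable on the product. [folklore] -/
theorem measurable_traceDeficitSum :
    Measurable fun v : B → Matrix.specialUnitaryGroup (Fin N) ℂ => ∑ b, (Matrix.trace (1 - ((v b : Matrix.specialUnitaryGroup (Fin N) ℂ) : Matrix (Fin N) (Fin N) ℂ))).re := by
  refine Finset.measurable_sum _ fun b _ => ?_
  have hc : Continuous fun U : Matrix.specialUnitaryGroup (Fin N) ℂ => (Matrix.trace (1 - (U : Matrix (Fin N) (Fin N) ℂ))).re :=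
    Complex.continuous_re.comp ((continuous_const.sub continuous_subtype_val).matrix_trace)
  exact hc.measurable.comp (measurable_pi_apply b)

/-- On the inner window `Π_b SB_ρ` the quadratic trace profile is at most `#bonds·ρ²∕(4σ)` (`σ > 0`; at `ρ² = 2σ` this is V27's `#bonds∕2`). [folklore] -/
theorem quadProfile_le_on_innerWindow {σ ρ : ℝ} (hσ0 : 0 < σ) {v : B → Matrix.specialUnitaryGroup (Fin N) ℂ}
    (hv : v ∈ (Set.univ.pi fun _ : B => {V : Matrix.specialUnitaryGroup (Fin N) ℂ | ‖(V : Matrix (Fin N) (Fin N) ℂ) - 1‖ ≤ ρ})) :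
    (2 * σ)⁻¹ * ∑ b, (Matrix.trace (1 - ((v b : Matrix.specialUnitaryGroup (Fin N) ℂ) : Matrix (Fin N) (Fin N) ℂ))).re ≤ (Fintype.card B : ℝ) * ρ ^ 2 / (4 * σ) := by
  have hsum : ∑ b, (Matrix.trace (1 - ((v b : Matrix.specialUnitaryGroup (Fin N) ℂ) : Matrix (Fin N) (Fin N) ℂ))).re ≤ ∑ _b : B, ρ ^ 2 / 2 :=
    Finset.sum_le_sum fun b _ => re_trace_one_sub_le_of_mem_sball (hv b (Set.mem_univ b))
  rw [Finset.sum_const, Finset.card_univ, nsmul_eq_mul] at hsum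
  calc (2 * σ)⁻¹ * ∑ b, (Matrix.trace (1 - ((v b : Matrix.specialUnitaryGroup (Fin N) ℂ) : Matrix (Fin N) (Fin N) ℂ))).re
      ≤ (2 * σ)⁻¹ * ((Fintype.card B : ℝ) * (ρ ^ 2 / 2)) := mul_le_mul_of_nonneg_left hsum (by positivity)
    _ = (Fintype.card B : ℝ) * ρ ^ 2 / (4 * σ) := by field_simp; ring

/-- `exp(−(2σ)⁻¹·Σ_b Re tr(1 − v_b))` is integrable for the product Haar probability (measurable, bounded by `1`; `σ > 0`). [folklore] -/
theorem integrable_exp_neg_quadProfile {σ : ℝ} (hσ0 : 0 < σ) :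
    Integrable (fun v : B → Matrix.specialUnitaryGroup (Fin N) ℂ => exp (-((2 * σ)⁻¹ * ∑ b, (Matrix.trace (1 - ((v b : Matrix.specialUnitaryGroup (Fin N) ℂ) : Matrix (Fin N) (Fin N) ℂ))).re)))
      (Measure.pi fun _ : B => haarProbability (Matrix.specialUnitaryGroup (Fin N) ℂ)) := by
  refine Integrable.mono' (integrable_const (1 : ℝ)) ?_ (Filter.Eventually.of_forall fun v => ?_)
  · exact (Real.measurable_exp.comp ((measurable_const.mul measurable_traceDeficitSum).neg)).aestronglyMeasurable
  · rw [Real.norm_eq_abs, abs_of_pos (exp_pos _), Real.exp_le_one_iff, neg_nonpos]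
    exact mul_nonneg (by positivity) (Finset.sum_nonneg fun b _ => re_trace_one_sub_nonneg (v b))

/-- **THE QUADRATIC PROFILE'S VOLUME LETTER, `SU(N)`, ALL `N`**: for `0 < σ`, `ρ ≤ η` and any inner-window letter (`κ(Π_b SB_ρ) > 0`, `−log κ(Π_b SB_ρ) ≤ b`),
`−log ∫_{Π SB_η} exp(−(2σ)⁻¹Σ_b Re tr(1 − v_b)) dκ ≤ #bonds·ρ²∕(4σ) + b` — with V29's letter at `ρ² = 2σ = 2g²`: `((N² − 1)∕2)·log g⁻² + O(1)` per bond, print's «`−½d(𝔤)log g_k⁻² + log σ₀`» per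
degree of freedom with `d(𝔤) = N² − 1`, in print's INTEGRATED shape. [folklore] -/
theorem neg_log_quadProfileVolume_le {σ ρ η b : ℝ} (hσ0 : 0 < σ) (hρη : ρ ≤ η)
    (hpos : 0 < ((Measure.pi fun _ : B => haarProbability (Matrix.specialUnitaryGroup (Fin N) ℂ)) (Set.univ.pi fun _ : B => {V : Matrix.specialUnitaryGroup (Fin N) ℂ | ‖(V : Matrix (Fin N) (Fin N) ℂ) - 1‖ ≤ ρ})).toReal)
    (hvol : -Real.log ((Measure.pi fun _ : B => haarProbability (Matrix.specialUnitaryGroup (Fin N) ℂ)) (Set.univ.pi fun _ : B => {V : Matrix.specialUnitaryGroup (Fin N) ℂ | ‖(V : Matrix (Fin N) (Fin N) ℂ) - 1‖ ≤ ρ})).toReal ≤ b) :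
    -Real.log (∫ v in (Set.univ.pi fun _ : B => {V : Matrix.specialUnitaryGroup (Fin N) ℂ | ‖(V : Matrix (Fin N) (Fin N) ℂ) - 1‖ ≤ η}),
        exp (-((2 * σ)⁻¹ * ∑ b, (Matrix.trace (1 - ((v b : Matrix.specialUnitaryGroup (Fin N) ℂ) : Matrix (Fin N) (Fin N) ℂ))).re)) ∂(Measure.pi fun _ : B => haarProbability (Matrix.specialUnitaryGroup (Fin N) ℂ)))
      ≤ (Fintype.card B : ℝ) * ρ ^ 2 / (4 * σ) + b :=
  neg_log_profileVolume_le hρη hpos hvol _ (fun _ hv => quadProfile_le_on_innerWindow hσ0 hv) (integrable_exp_neg_quadProfile hσ0).integrableOn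

/-! ## §3 The letter is ADDITIVE over the bonds (exact factorisation), and bounded on the other side by the window letter -/

/-- **EXACT FACTORISATION** (product measure, product window, product-form profile) on `SU(N)`: for any σ-finite measure `μ`, window `s`, one-bond profile `f` and constant `c`,
`∫_{Π_b s} exp(−c·Σ_b f(v_b)) d(⊗_b μ) = (∫_s exp(−c·f) dμ)^{#bonds}` (Mathlib's `integral_fintype_prod_eq_pow` on the restricted product measure, `Measure.restrict_pi_pi`). [folklore] -/
theorem profileVolume_eq_pow (μ : Measure (Matrix.specialUnitaryGroup (Fin N) ℂ)) [SigmaFinite μ] (s : Set (Matrix.specialUnitaryGroup (Fin N) ℂ))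
    (f : Matrix.specialUnitaryGroup (Fin N) ℂ → ℝ) (c : ℝ) :
    ∫ v in (Set.univ.pi fun _ : B => s), exp (-(c * ∑ b, f (v b))) ∂(Measure.pi fun _ : B => μ) = (∫ u in s, exp (-(c * f u)) ∂μ) ^ Fintype.card B := by
  rw [Measure.restrict_pi_pi (fun _ : B => μ) (fun _ : B => s)]
  have h : ∀ v : B → Matrix.specialUnitaryGroup (Fin N) ℂ, exp (-(c * ∑ b, f (v b))) = ∏ b, exp (-(c * f (v b))) := by
    intro v; rw [Finset.mul_sum, ← Real.exp_sum, ← Finset.sum_neg_distrib]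
  simp_rw [h]
  exact integral_fintype_prod_eq_pow (𝕜 := ℝ) (μ := μ.restrict s) (fun u => exp (-(c * f u)))

/-- Hence the quadratic trace profile's letter is EXACTLY `#bonds` times the one-bond letter. [folklore] -/
theorem quadProfileVolume_eq_pow (σ η : ℝ) :
    ∫ v in (Set.univ.pi fun _ : B => {V : Matrix.specialUnitaryGroup (Fin N) ℂ | ‖(V : Matrix (Fin N) (Fin N) ℂ) - 1‖ ≤ η}),
        exp (-((2 * σ)⁻¹ * ∑ b, (Matrix.trace (1 - ((v b : Matrix.specialUnitaryGroup (Fin N) ℂ) : Matrix (Fin N) (Fin N) ℂ))).re)) ∂(Measure.pi fun _ : B => haarProbability (Matrix.specialUnitaryGroup (Fin N) ℂ)) =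
      (∫ u in {V : Matrix.specialUnitaryGroup (Fin N) ℂ | ‖(V : Matrix (Fin N) (Fin N) ℂ) - 1‖ ≤ η},
        exp (-((2 * σ)⁻¹ * (Matrix.trace (1 - (u : Matrix (Fin N) (Fin N) ℂ))).re)) ∂(haarProbability (Matrix.specialUnitaryGroup (Fin N) ℂ))) ^ Fintype.card B :=
  profileVolume_eq_pow _ _ (fun u : Matrix.specialUnitaryGroup (Fin N) ℂ => (Matrix.trace (1 - (u : Matrix (Fin N) (Fin N) ℂ))).re) _

/-- **THE OTHER SIDE, FROM THE WINDOW LETTER**: for `q ≥ 0` on `Π_b SB_η`, any LOWER letter `b′ ≤ −log κ(Π_b SB_η)` (V29's `exists_abs_neg_log_pi_sball_sub_le`) bounds the profile letter from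
below: `b′ ≤ −log ∫_{Π SB_η} e^{−q} dκ` (the integrand is `≤ 1`). [folklore] -/
theorem le_neg_log_profileVolume {η b' : ℝ} (q : (B → Matrix.specialUnitaryGroup (Fin N) ℂ) → ℝ)
    (hvol' : b' ≤ -Real.log ((Measure.pi fun _ : B => haarProbability (Matrix.specialUnitaryGroup (Fin N) ℂ)) (Set.univ.pi fun _ : B => {V : Matrix.specialUnitaryGroup (Fin N) ℂ | ‖(V : Matrix (Fin N) (Fin N) ℂ) - 1‖ ≤ η})).toReal)
    (hq0 : ∀ v ∈ (Set.univ.pi fun _ : B => {V : Matrix.specialUnitaryGroup (Fin N) ℂ | ‖(V : Matrix (Fin N) (Fin N) ℂ) - 1‖ ≤ η}), 0 ≤ q v)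
    (hint : IntegrableOn (fun v => exp (-q v)) (Set.univ.pi fun _ : B => {V : Matrix.specialUnitaryGroup (Fin N) ℂ | ‖(V : Matrix (Fin N) (Fin N) ℂ) - 1‖ ≤ η})
      (Measure.pi fun _ : B => haarProbability (Matrix.specialUnitaryGroup (Fin N) ℂ)))
    (hposI : 0 < ∫ v in (Set.univ.pi fun _ : B => {V : Matrix.specialUnitaryGroup (Fin N) ℂ | ‖(V : Matrix (Fin N) (Fin N) ℂ) - 1‖ ≤ η}), exp (-q v) ∂(Measure.pi fun _ : B => haarProbability (Matrix.specialUnitaryGroup (Fin N) ℂ))) :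
    b' ≤ -Real.log (∫ v in (Set.univ.pi fun _ : B => {V : Matrix.specialUnitaryGroup (Fin N) ℂ | ‖(V : Matrix (Fin N) (Fin N) ℂ) - 1‖ ≤ η}), exp (-q v) ∂(Measure.pi fun _ : B => haarProbability (Matrix.specialUnitaryGroup (Fin N) ℂ))) := by
  set κ : Measure (B → Matrix.specialUnitaryGroup (Fin N) ℂ) := Measure.pi fun _ : B => haarProbability (Matrix.specialUnitaryGroup (Fin N) ℂ) with hκ
  set W : Set (B → Matrix.specialUnitaryGroup (Fin N) ℂ) := Set.univ.pi fun _ : B => {V : Matrix.specialUnitaryGroup (Fin N) ℂ | ‖(V : Matrix (Fin N) (Fin N) ℂ) - 1‖ ≤ η} with hW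
  have hWm : MeasurableSet W := MeasurableSet.univ_pi fun _ => measurableSet_sball η
  have hle : ∫ v in W, exp (-q v) ∂κ ≤ (κ W).toReal := by
    have h1 : ∫ v in W, exp (-q v) ∂κ ≤ ∫ v in W, (1 : ℝ) ∂κ :=
      setIntegral_mono_on hint (integrableOn_const (measure_ne_top _ _)) hWm fun v hv => by rw [Real.exp_le_one_iff]; linarith [hq0 v hv]
    rwa [setIntegral_const, smul_eq_mul, mul_one, measureReal_def] at h1
  have hlog := Real.log_le_log hposI hle
  linarith

/-! ## §4 The junction: the creation price in print's profile shape on `bonds → SU(N)`, with the denominator's letter folded in -/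

section Junction

variable {Y : Type*} [MeasurableSpace Y] (μ : Measure Y) [SFinite μ]

/-- **THE CREATION-STEP PRICE IN PRINT'S PROFILE SHAPE, LETTER VALUED, `SU(N)`, ALL `N`**: near fibre `bonds → SU(N)`, product Haar `κ`, far space `(Y, μ)`; `F, G, w ≥ 0`; `G ≥ 1` on the
centred window `U₀(y)·Π_b SB_η` (`hGwin`); the interaction exceeds the base level `m₀ y` there by at most a PROFILE `q` of the relative position (`hIprof`); `q ≤ q₀` on the inner window
`Π_b SB_ρ` (`ρ ≤ η`), `e^{−q}` integrable on `Π_b SB_η`; `F` lives where SOME bond is at Hilbert–Schmidt distance `≥ δ′` from the centre (`hF`), bond-quadratic floor of modulus `λ` there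
(`hconv`); inner-window letter `κ(Π_b SB_ρ) > 0`, `−log κ(Π_b SB_ρ) ≤ b`.  Then `∫ F·w·e^{−I} ≤ exp(−(λ∕2)δ′² + q₀ + b)·(∫F dκ)·∫ G·w·e^{−I}`. [folklore] -/
theorem creationPrice_SUN_profile_valued {ρ η q₀ b : ℝ} (hρη : ρ ≤ η)
    (hpos : 0 < ((Measure.pi fun _ : B => haarProbability (Matrix.specialUnitaryGroup (Fin N) ℂ)) (Set.univ.pi fun _ : B => {V : Matrix.specialUnitaryGroup (Fin N) ℂ | ‖(V : Matrix (Fin N) (Fin N) ℂ) - 1‖ ≤ ρ})).toReal)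
    (hvol : -Real.log ((Measure.pi fun _ : B => haarProbability (Matrix.specialUnitaryGroup (Fin N) ℂ)) (Set.univ.pi fun _ : B => {V : Matrix.specialUnitaryGroup (Fin N) ℂ | ‖(V : Matrix (Fin N) (Fin N) ℂ) - 1‖ ≤ ρ})).toReal ≤ b)
    (F G : (B → Matrix.specialUnitaryGroup (Fin N) ℂ) → ℝ) (w : Y → ℝ) (I : (B → Matrix.specialUnitaryGroup (Fin N) ℂ) × Y → ℝ) (m₀ : Y → ℝ)
    (U₀ : Y → (B → Matrix.specialUnitaryGroup (Fin N) ℂ)) (q : (B → Matrix.specialUnitaryGroup (Fin N) ℂ) → ℝ) {lam δ' : ℝ}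
    (hF0 : ∀ x, 0 ≤ F x) (hG0 : ∀ x, 0 ≤ G x) (hw0 : ∀ y, 0 ≤ w y) (hlam : 0 ≤ lam) (hδ : 0 ≤ δ')
    (hq : ∀ v ∈ (Set.univ.pi fun _ : B => {V : Matrix.specialUnitaryGroup (Fin N) ℂ | ‖(V : Matrix (Fin N) (Fin N) ℂ) - 1‖ ≤ ρ}), q v ≤ q₀)
    (hint : IntegrableOn (fun v => exp (-q v)) (Set.univ.pi fun _ : B => {V : Matrix.specialUnitaryGroup (Fin N) ℂ | ‖(V : Matrix (Fin N) (Fin N) ℂ) - 1‖ ≤ η})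
      (Measure.pi fun _ : B => haarProbability (Matrix.specialUnitaryGroup (Fin N) ℂ)))
    (hF : ∀ x y, F x ≠ 0 → w y ≠ 0 → ∃ b : B, δ' ≤ ‖(((U₀ y b)⁻¹ * x b : Matrix.specialUnitaryGroup (Fin N) ℂ) : Matrix (Fin N) (Fin N) ℂ) - 1‖)
    (hconv : ∀ x y, F x ≠ 0 → w y ≠ 0 → m₀ y + lam / 2 * ∑ b, ‖(((U₀ y b)⁻¹ * x b : Matrix.specialUnitaryGroup (Fin N) ℂ) : Matrix (Fin N) (Fin N) ℂ) - 1‖ ^ 2 ≤ I (x, y))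
    (hGwin : ∀ y v, w y ≠ 0 → v ∈ (Set.univ.pi fun _ : B => {V : Matrix.specialUnitaryGroup (Fin N) ℂ | ‖(V : Matrix (Fin N) (Fin N) ℂ) - 1‖ ≤ η}) → 1 ≤ G (U₀ y * v))
    (hIprof : ∀ y v, w y ≠ 0 → v ∈ (Set.univ.pi fun _ : B => {V : Matrix.specialUnitaryGroup (Fin N) ℂ | ‖(V : Matrix (Fin N) (Fin N) ℂ) - 1‖ ≤ η}) → I (U₀ y * v, y) ≤ m₀ y + q v)
    (hFi : Integrable F (Measure.pi fun _ : B => haarProbability (Matrix.specialUnitaryGroup (Fin N) ℂ)))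
    (hGI : ∀ y, w y ≠ 0 → Integrable (fun x => G x * exp (-I (x, y))) (Measure.pi fun _ : B => haarProbability (Matrix.specialUnitaryGroup (Fin N) ℂ)))
    (hA' : Integrable (fun z : (B → Matrix.specialUnitaryGroup (Fin N) ℂ) × Y => F z.1 * w z.2 * exp (-I z)) ((Measure.pi fun _ : B => haarProbability (Matrix.specialUnitaryGroup (Fin N) ℂ)).prod μ))
    (hB' : Integrable (fun z : (B → Matrix.specialUnitaryGroup (Fin N) ℂ) × Y => G z.1 * w z.2 * exp (-I z)) ((Measure.pi fun _ : B => haarProbability (Matrix.specialUnitaryGroup (Fin N) ℂ)).prod μ)) :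
    ∫ z, F z.1 * w z.2 * exp (-I z) ∂((Measure.pi fun _ : B => haarProbability (Matrix.specialUnitaryGroup (Fin N) ℂ)).prod μ) ≤
      exp (-(lam / 2 * δ' ^ 2) + q₀ + b) * (∫ x, F x ∂(Measure.pi fun _ : B => haarProbability (Matrix.specialUnitaryGroup (Fin N) ℂ))) *
        ∫ z, G z.1 * w z.2 * exp (-I z) ∂((Measure.pi fun _ : B => haarProbability (Matrix.specialUnitaryGroup (Fin N) ℂ)).prod μ) := by
  set κ : Measure (B → Matrix.specialUnitaryGroup (Fin N) ℂ) := Measure.pi fun _ : B => haarProbability (Matrix.specialUnitaryGroup (Fin N) ℂ) with hκ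
  set W : Set (B → Matrix.specialUnitaryGroup (Fin N) ℂ) := Set.univ.pi fun _ : B => {V : Matrix.specialUnitaryGroup (Fin N) ℂ | ‖(V : Matrix (Fin N) (Fin N) ℂ) - 1‖ ≤ η} with hW
  set a : ℝ := lam / 2 * δ' ^ 2 with ha
  have hWm : MeasurableSet W := MeasurableSet.univ_pi fun _ => measurableSet_sball η
  -- the integrated (shifted) profile and its letter
  have hsplit : ∫ v in W, exp (-(q v - a)) ∂κ = exp a * ∫ v in W, exp (-q v) ∂κ := by
    rw [← integral_const_mul]
    refine integral_congr_ae (ae_of_all _ fun v => ?_)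
    show exp (-(q v - a)) = exp a * exp (-q v)
    rw [← Real.exp_add]; ring_nf
  have hvolI : 0 < ∫ v in W, exp (-q v) ∂κ := profileVolume_pos hρη hpos q hq hint
  have hletter : -Real.log (∫ v in W, exp (-q v) ∂κ) ≤ q₀ + b := neg_log_profileVolume_le hρη hpos hvol q hq hint
  have hqpos' : 0 < ∫ v in W, exp (-(q v - a)) ∂κ := by rw [hsplit]; positivity
  -- the floor rides in the level
  have hnum : ∀ x y, F x ≠ 0 → w y ≠ 0 → m₀ y + a ≤ I (x, y) := by
    intro x y hx hy
    obtain ⟨b₀, hb⟩ := hF x y hx hy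
    have hsq : δ' ^ 2 ≤ ∑ b, ‖(((U₀ y b)⁻¹ * x b : Matrix.specialUnitaryGroup (Fin N) ℂ) : Matrix (Fin N) (Fin N) ℂ) - 1‖ ^ 2 :=
      (pow_le_pow_left₀ hδ hb 2).trans
        (Finset.single_le_sum (f := fun b => ‖(((U₀ y b)⁻¹ * x b : Matrix.specialUnitaryGroup (Fin N) ℂ) : Matrix (Fin N) (Fin N) ℂ) - 1‖ ^ 2) (fun b _ => sq_nonneg _) (Finset.mem_univ b₀))
    have := mul_le_mul_of_nonneg_left hsq (by positivity : 0 ≤ lam / 2)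
    rw [ha]; linarith [hconv x y hx hy]
  have hIprof' : ∀ y v, w y ≠ 0 → v ∈ W → I (U₀ y * v, y) ≤ (m₀ y + a) + (q v - a) := by
    intro y v hy hv; have := hIprof y v hy hv; linarith
  have key := relFibre_moment_le_of_centredProfile κ μ F G w I (fun y => m₀ y + a) U₀ W (fun v => q v - a) hF0 hG0 hw0 hWm hqpos' hnum hGwin hIprof' hFi hGI hA' hB'
  rw [hsplit] at key
  -- fold the letter: `(∫F) ∕ (e^{a}·V) ≤ e^{−a + q₀ + b}·∫F`
  have hFint : 0 ≤ ∫ x, F x ∂κ := integral_nonneg hF0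
  have hint0 : 0 ≤ ∫ z, G z.1 * w z.2 * exp (-I z) ∂(κ.prod μ) := integral_nonneg fun z => mul_nonneg (mul_nonneg (hG0 _) (hw0 _)) (exp_pos _).le
  have hVinv : (∫ v in W, exp (-q v) ∂κ)⁻¹ ≤ exp (q₀ + b) := by
    rw [← Real.exp_log hvolI, ← Real.exp_neg]
    exact Real.exp_le_exp.2 (by linarith)
  have hstep : (∫ x, F x ∂κ) / (exp a * ∫ v in W, exp (-q v) ∂κ) ≤ exp (-(lam / 2 * δ' ^ 2) + q₀ + b) * ∫ x, F x ∂κ := by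
    rw [div_eq_mul_inv, mul_inv, ← Real.exp_neg, show -(lam / 2 * δ' ^ 2) + q₀ + b = -a + (q₀ + b) by rw [ha]; ring, Real.exp_add]
    calc (∫ x, F x ∂κ) * (exp (-a) * (∫ v in W, exp (-q v) ∂κ)⁻¹) = exp (-a) * (∫ v in W, exp (-q v) ∂κ)⁻¹ * ∫ x, F x ∂κ := by ring
      _ ≤ exp (-a) * exp (q₀ + b) * ∫ x, F x ∂κ := mul_le_mul_of_nonneg_right (mul_le_mul_of_nonneg_left hVinv (exp_pos _).le) hFint
  exact key.trans (mul_le_mul_of_nonneg_right hstep hint0)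

end Junction

/-! ## §5 Sanity -/

/-- At `ρ² = 2σ` the inner-window bound of §2 is V27's `#bonds∕2`. -/
example {σ : ℝ} (hσ : 0 < σ) (n : ℕ) : (n : ℝ) * (Real.sqrt (2 * σ)) ^ 2 / (4 * σ) = n / 2 := by
  rw [Real.sq_sqrt (by positivity)]; field_simp; ring

end Summit.QuantumFields.BalabanUV.T4Continuum.NE7b.CompactFibreProfileVolumeSUN

end
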